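import Literature.Geometry.Riemannian.ChangGurskyYangWeylBudget
import Literature.Geometry.Riemannian.ChangGurskyYangRegularity
import Literature.Geometry.Riemannian.ChenZhuConformalPIC
import Literature.Geometry.Riemannian.PICSphereFacts
import Literature.Geometry.Riemannian.YamabePositivity
import Literature.Geometry.Riemannian.NeumannIsotropicFormPos
import Literature.Geometry.Riemannian.CkNecks
import Literature.Geometry.Lorentzian.WeylConformal
import HarnessLib

/-!
# Chang–Gursky–Yang's sphere theorem along the PIC line (Chen–Zhu 2014): Theorem A, in the
# vended special case, from Hamilton's PIC sphere theorem and Chen–Zhu's conformal PIC theorem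

Second companion ("Proofs") file of `Literature/Geometry/Riemannian/ChangGurskyYang.lean`, which
vends the named fact `Literature.Geometry.Riemannian.changGurskyYang_sphere_four` (Chang–Gursky–Yang
2003, Thm. A, in the simply connected `scal > 0` special case: a closed simply connected `4`-manifold
carrying a metric with `scal > 0` and Weyl energy `∫|W|² dV < 32π²` is diffeomorphic to `S⁴`).
`ChangGurskyYangProofs.lean` formalizes the PRINTED line of §2 of the paper (Chern–Gauss–Bonnet ⇒
(1.2); the fully nonlinear conformal PDE of [CGY1]/[CGY2], Thm. 1.4 ⇒ pointwise pinching; Margerin's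
weak-pinching sphere theorem), leaving Margerin's theorem, Chern–Gauss–Bonnet and Thm. 1.4 as
hypotheses. This file formalizes the INDEPENDENT line of B.-L. Chen and X.-P. Zhu, *A conformally
invariant classification theorem in four dimensions*, Comm. Anal. Geom. 22 (2014) 811–831
(arXiv:1206.5051), p. 4: "Theorem 1.2 [= Chang–Gursky–Yang's Thm. A] can be deduced from
Theorem 1.4" — the route through POSITIVE ISOTROPIC CURVATURE, whose two deep inputs are named
facts ALREADY IN THE TREE:

* `chenZhu2014_conformal_pic_four` (`ChenZhuConformalPIC.lean`; Chen–Zhu 2014, Cor. 2.2 with §3 ¶1,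
  = Gursky–LeBrun 1998, Prop. 3): a positive isotropic Yamabe constant `𝒴_f(M⁴,𝒞) > 0`,
  `f(W) = 6 max{λ_max(W₊), λ_max(W₋)}`, yields a conformal metric of positive isotropic curvature —
  a SEMILINEAR problem ("This step is much easier than that of Theorem (CGY)", ibid. p. 4);
* `hamilton_pic_sphere_four` (`PICSphereFacts.lean`; Hamilton 1997, Cor. 1.2 (a), completed by
  Chen–Zhu 2006 and Chen–Tang–Zhu 2012): a closed simply connected `4`-manifold with a metric of
  positive isotropic curvature is diffeomorphic to `S⁴`.

## Content (everything PROVED; no definition, no named fact is introduced)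

1. **Pointwise algebra** (Chen–Zhu 2014, §1, p. 4: `|W±|² ≥ (3/2) λ_max(W±)²` for the trace-free
   `W±`, with Hamilton 1997, §1.2: `K(e) = A₂₂ + A₃₃`, `tr A = R/2`). For an algebraic curvature array
   `R_{abcd}` (pair-antisymmetric, pair-symmetric, first Bianchi): the isotropic curvature
   `K = R₀₂₂₀ + R₀₃₃₀ + R₁₂₂₁ + R₁₃₃₁ − 2R₀₁₃₂` (the formula of `isotropicCurvature`) is
   `A₁₁ + A₂₂` for Hamilton's self-dual block `A` (`WeylBlocks.iso_eq_blockArr_add`),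
   `A₀₀ + A₁₁ + A₂₂ = R/2` (`WeylBlocks.blockArr_trace_eq`), hence `R − 3K = 3Å₀₀` and, by
   `Σ W² = ‖Å‖² + ‖C̊‖²` (`ChangGurskyYangWeylBudget.lean`), **`(R − 3K)² ≤ 6 Σ_{ijkl} W_{ijkl}²`**
   (`WeylBlocks.sq_scalArr_sub_three_mul_iso_le`; `6ΣÅᵢᵢ² − 9Å₀₀² = 3(Å₁₁ − Å₂₂)² ≥ 0`). For a
   `C²` metric in an orthonormal `4`-frame: `(R(x) − 3K_iso(e))² ≤ 6|W_g|²(x)` in the `(0,4)`-norm of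
   Chang–Gursky–Yang, Remark 2 (`sq_scalarCurvature_sub_three_mul_isotropicCurvature_le`), so
   `R − √(6|W|²) ≤ 3K_iso(e) ≤ R + √(6|W|²)` and the same for `3K_min`
   (`scalarCurvature_sub_sqrt_le_minIsotropicCurvature`, `minIsotropicCurvature_le_scalarCurvature_add_sqrt`,
   on the API of `NeumannIsotropicFormPos.lean`).
2. **The Yamabe bound** `Y(M,[G]) √(∫u⁴) ≤ ∫R_G u² + 6∫G⁻¹(du,du)` for smooth `u > 0`
   (`yamabeConstant_mul_sqrt_le`: the conformal metric `u²G` — `confSmul` of `CkNecks.lean`, packaged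
   in `exists_conformal_sq` — lies in the class, and its Yamabe quotient is Aubin's `J(ψ)`,
   `totalScalarCurvature_conformal_sq` of `YamabePositivity.lean`).
3. **The bridge** (`isotropicYamabe_coercive_of_weylEnergy_lt`; Chen–Zhu 2014, p. 4 with Lemma 2.3
   and Remark 1.8): `Y(M,[G]) > 0` and `6∫|W_G|² < Y(M,[G])²` give
   `(Y − √(6∫|W|²)) ‖u‖₄² ≤ ∫(6|du|² + 3K_min u²)` for all smooth `u > 0` — the hypothesis of
   `chenZhu2014_conformal_pic_four` — by 1, 2, Hölder, and continuity of `K_min`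
   (`continuous_minIsotropicCurvature`, `NeumannIsotropicFormPos.lean`).
4. **The elementary regime** (`sphere_of_weylEnergy_lt_yamabe_sq`): given the two named facts,
   `Y > 0` and `6∫|W|² < Y²` on a closed simply connected `4`-manifold force `M ≅ S⁴` (Chen–Zhu 2014,
   Thm. 1.4 in the simply connected case, in `(0,4)`-Weyl-norm form).
5. **Theorem A (vended special case) along the PIC line**
   (`changGurskyYang_sphere_four_of_pic_of_chenZhu_of_chernGaussBonnet_of_aubin_of_weylConformal`):
   `changGurskyYang_sphere_four` from `hamilton_pic_sphere_four`, `chenZhu2014_conformal_pic_four`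
   and three classical inputs stated verbatim as hypotheses — Chern–Gauss–Bonnet with `χ(M) ≥ 2`
   (the hypothesis `hCGB` of `ChangGurskyYangProofs.lean`, verbatim), the Yamabe problem below the
   sphere constant `λ(S⁴) = 8√6π` (Lee–Parker 1987, Thm. A / Thm. 4.5 / Thm. 3.3: Yamabe,
   Trudinger, Aubin), and the conformal invariance of `∫|W|² dV` in dimension four (Besse 1987,
   1.159). Proof as on p. 4 of Chen–Zhu: `Y > 0` (`yamabeConstant_pos_of_scalarCurvature_pos`);
   either `6∫|W|² < Y²` (regime 4), or `Y < 8√3π < λ(S⁴)` and the Yamabe metric `g' = ψ²g`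
   (`R_{g'} ≡ R₀`, `Y = R₀√V'`) has, by Chern–Gauss–Bonnet and `σ₂(A) = R₀²/24 − ½|E|² ≤ R₀²/24`,
   `6∫|W_{g'}|² < R₀²V' = Y(M,[g'])²` — regime 4 again.
6. **The same with the conformal invariance of the Weyl energy discharged**
   (`changGurskyYang_sphere_four_of_pic_of_chenZhu_of_chernGaussBonnet_of_aubin`): hypothesis
   `hWeylConf` of 5 is the theorem `PseudoRiemannianMetric.weylEnergy_conformal_sq_four` of
   `Lorentzian/WeylConformal.lean` (proved in this tree: naturality of `W` under the inverse chart,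
   Besse 1987, Thm. 1.159 (c), and `dV_{ψ²g} = ψ⁴ dV_g`), so along the PIC line the remaining proof
   debt of `changGurskyYang_sphere_four` is exactly: the two named facts, Chern–Gauss–Bonnet with
   `χ ≥ 2`, and the Yamabe problem below the sphere constant.

## Why this line (novelty relative to the tree)

The printed line needs two isolated deep theorems that nothing else in the tree uses (Margerin
1998; the `σ₂`-Monge–Ampère theory of [CGY1], [CGY2]). The PIC line trades them for the two named
facts above, which are central to the tree's `SmoothPoincare4` programme (routes PIC,
IsotropicCorkBracketing; `GurskyEinsteinGap.lean` already consumes `hamilton_pic_sphere_four` the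
same way), plus the classical subcritical Yamabe theorem and a classical tensor identity. When
`hamilton_pic_sphere_four` and `chenZhu2014_conformal_pic_four` are discharged, the remaining debt of
`changGurskyYang_sphere_four` along this line is exactly `hCGB`, `hAubin`, `hWeylConf`.

## References

* S.-Y. A. Chang, M. J. Gursky, P. C. Yang, *A conformally invariant sphere theorem in four
  dimensions*, Publ. Math. IHÉS 98 (2003) 105–143: Thm. A, Remark 2, (0.4), (1.1), §2.
  [ChangGurskyYang2003]
* B.-L. Chen, X.-P. Zhu, *A conformally invariant classification theorem in four dimensions*,
  Comm. Anal. Geom. 22 (2014) 811–831, arXiv:1206.5051: Thm. 1.2, Thm. 1.4, §1 p. 4 (deduction of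
  Thm. 1.2 from Thm. 1.4), Lemma 2.1, Cor. 2.2, Lemma 2.3, Remark 1.8, §3. [ChenZhu2014]
* R. S. Hamilton, *Four-manifolds with positive isotropic curvature*, Comm. Anal. Geom. 5 (1997)
  1–92: §1.2 (blocks `A`, `C`; `K = A₂₂ + A₃₃`), Cor. 1.2 (a). [Hamilton1997]
* J. M. Lee, T. H. Parker, *The Yamabe problem*, Bull. AMS 17 (1987) 37–91: Thm. A (p. 39),
  Thm. 3.3 (p. 50), Thm. 4.5 (p. 55), (1.4)–(1.5). [LeeParker1987]
* A. L. Besse, *Einstein Manifolds* (1987), Thm. 1.159 (conformal changes). [Besse1987]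
* T. Aubin, *Nonlinear Analysis on Manifolds* (1982), Ch. 6, §6.4. [Aubin1982]
* M. Micallef, J. D. Moore, Ann. of Math. 127 (1988), §1 (isotropic curvature). [MicallefMoore1988]
* A. Hatcher, *Algebraic Topology* (2002), Thm. 3.30. [Hatcher2002]
-/

noncomputable section

open Bundle Finset Module MeasureTheory Set Filter Function
open scoped Manifold ContDiff Topology ENNReal

namespace Literature.Geometry.Riemannian

/-! ### The isotropic curvature array and Hamilton's block `A` -/

namespace WeylBlocks

/-! Throughout, the isotropic curvature of a frame array `R_{abcd} = Rm(e_a,e_b,e_c,e_d)` is the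
expression `R 0 2 2 0 + R 0 3 3 0 + R 1 2 2 1 + R 1 3 3 1 - 2 * R 0 1 3 2` — the formula of
`isotropicCurvature` (`IsotropicCurvature.lean`, Micallef–Moore's `K₁₃ + K₁₄ + K₂₃ + K₂₄ − 2R₁₂₄₃`),
kept unfolded so that this file introduces no definition. -/

/-- **Hamilton 1997, §1.2 (p. 5): `K(e) = A₂₂ + A₃₃`** — the isotropic curvature of the frame is
the sum of two diagonal entries of the self-dual block `A` (first Bianchi identity and pair
symmetry for the cross terms). [cite: Hamilton1997, §1.2, p. 5] -/
theorem iso_eq_blockArr_add (R : Fin 4 → Fin 4 → Fin 4 → Fin 4 → ℝ)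
    (h12 : ∀ a b c d, R a b c d = -R b a c d) (h34 : ∀ a b c d, R a b c d = -R a b d c)
    (hp : ∀ a b c d, R a b c d = R c d a b)
    (hb : R 0 1 2 3 + R 1 2 0 3 + R 2 0 1 3 = 0) :
    R 0 2 2 0 + R 0 3 3 0 + R 1 2 2 1 + R 1 3 3 1 - 2 * R 0 1 3 2 =
      blockArr sdIdx sdIdx R 1 1 + blockArr sdIdx sdIdx R 2 2 := by
  simp only [blockArr, Fin.sum_univ_two, Fin.isValue, sdIdx_1_0, sdIdx_1_1, sdIdx_2_0,
    sdIdx_2_1]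
  have e1 : R 3 1 2 0 = R 0 2 1 3 := by rw [hp 3 1 2 0, h12 2 0 3 1, h34 0 2 3 1]; ring
  have e2 : R 1 2 3 0 = R 0 3 2 1 := by rw [hp 1 2 3 0, h12 3 0 1 2, h34 0 3 1 2]; ring
  have e3 : R 3 1 1 3 = R 1 3 3 1 := by rw [h12 3 1 1 3, h34 1 3 1 3]; ring
  have e4 : R 0 2 1 3 = -R 2 0 1 3 := by rw [h12 0 2 1 3]
  have e5 : R 0 3 2 1 = -R 1 2 0 3 := by rw [hp 0 3 2 1, h12 2 1 0 3]
  have e6 : R 0 1 3 2 = -R 0 1 2 3 := by rw [h34 0 1 3 2]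
  rw [e1, e2, e3, e4, e5, e6]
  linear_combination (2 : ℝ) * hb

/-- **`tr A = R/2`**: the trace of the self-dual block is half the scalar contraction
`scalArr R = Σ_{ij} R_{jiij}` (Hamilton 1997, §1.2: `tr A = tr C = R/4` in the `End(Λ²)`
normalisation, i.e. `R/2` for the blocks of squared-norm-`2` bivectors used here; cross terms
vanish by the first Bianchi identity). [cite: Hamilton1997, §1.2, p. 5] -/
theorem blockArr_trace_eq (R : Fin 4 → Fin 4 → Fin 4 → Fin 4 → ℝ)
    (h12 : ∀ a b c d, R a b c d = -R b a c d) (h34 : ∀ a b c d, R a b c d = -R a b d c)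
    (hp : ∀ a b c d, R a b c d = R c d a b)
    (hb : R 0 1 2 3 + R 1 2 0 3 + R 2 0 1 3 = 0) :
    blockArr sdIdx sdIdx R 0 0 + blockArr sdIdx sdIdx R 1 1 + blockArr sdIdx sdIdx R 2 2 =
      scalArr R / 2 := by
  have hz12 : ∀ a c d, R a a c d = 0 := fun a c d ↦ by have := h12 a a c d; linarith
  simp only [blockArr, scalArr, ricArr, Fin.sum_univ_two, Fin.sum_univ_four, Fin.isValue,
    sdIdx_0_0, sdIdx_0_1, sdIdx_1_0, sdIdx_1_1, sdIdx_2_0, sdIdx_2_1, hz12]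
  have e1 : R 3 1 2 0 = R 0 2 1 3 := by rw [hp 3 1 2 0, h12 2 0 3 1, h34 0 2 3 1]; ring
  have e2 : R 1 2 3 0 = R 0 3 2 1 := by rw [hp 1 2 3 0, h12 3 0 1 2, h34 0 3 1 2]; ring
  have e7 : R 2 3 1 0 = R 0 1 3 2 := by rw [hp 2 3 1 0, h12 1 0 2 3, h34 0 1 2 3]; ring
  have e4 : R 0 2 1 3 = -R 2 0 1 3 := by rw [h12 0 2 1 3]
  have e5 : R 0 3 2 1 = -R 1 2 0 3 := by rw [hp 0 3 2 1, h12 2 1 0 3]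
  have e6 : R 0 1 3 2 = -R 0 1 2 3 := by rw [h34 0 1 3 2]
  -- sectional terms `R_{baab} = R_{abba}`
  have s : ∀ a b, R b a a b = R a b b a := fun a b ↦ by rw [h12 b a a b, h34 a b a b]; ring
  rw [e1, e2, e7, e4, e5, e6, s 1 0, s 2 0, s 3 0, s 2 1, s 3 1, s 3 2]
  linear_combination (-2 : ℝ) * hb

/-- **`(R − 3K)² ≤ 6 Σ W²` for an algebraic curvature array** (Chen–Zhu 2014, §1, the two
displays before (1.9): `|W±|² ≥ (3/2) λ_max(W±)²` for the trace-free `W±`, combined with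
Hamilton's `K = A₂₂ + A₃₃ = tr A − A₁₁`, `tr A = R/2`, and `Σ W² = ‖Å‖² + ‖C̊‖²`
(`sum_weylArr_sq_eq_blocksNormSq`): `R − 3K = 3Å₁₁` and `6(Å₁₁² + Å₂₂² + Å₃₃²) − 9Å₁₁² =
3(Å₂₂ − Å₃₃)² ≥ 0`). [cite: ChenZhu2014, §1, proof of Thm. 1.2 from Thm. 1.4 (p. 4)] -/
theorem sq_scalArr_sub_three_mul_iso_le (R : Fin 4 → Fin 4 → Fin 4 → Fin 4 → ℝ)
    (h12 : ∀ a b c d, R a b c d = -R b a c d) (h34 : ∀ a b c d, R a b c d = -R a b d c)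
    (hp : ∀ a b c d, R a b c d = R c d a b)
    (hb : R 0 1 2 3 + R 1 2 0 3 + R 2 0 1 3 = 0) :
    (scalArr R - 3 * (R 0 2 2 0 + R 0 3 3 0 + R 1 2 2 1 + R 1 3 3 1 - 2 * R 0 1 3 2)) ^ 2 ≤
      6 * ∑ i, ∑ j, ∑ k, ∑ l, weylArr R i j k l ^ 2 := by
  rw [sum_weylArr_sq_eq_blocksNormSq R h12 h34 hp hb, iso_eq_blockArr_add R h12 h34 hp hb]
  set A := blockArr sdIdx sdIdx R with hA
  set C := blockArr asdIdx asdIdx R with hC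
  have htr : scalArr R = 2 * (A 0 0 + A 1 1 + A 2 2) := by
    have := blockArr_trace_eq R h12 h34 hp hb
    simp only [← hA] at this
    linarith
  -- keep only the diagonal entries of `Å`
  have hdiag : ∑ i : Fin 3, (A i i - (∑ k, A k k) / 3 * frameDelta i i) ^ 2 ≤ blocksNormSq R := by
    unfold blocksNormSq
    simp only [← hA, ← hC]
    refine Finset.sum_le_sum fun i _ ↦ ?_
    calc (A i i - (∑ k, A k k) / 3 * frameDelta i i) ^ 2
        ≤ (A i i - (∑ k, A k k) / 3 * frameDelta i i) ^ 2 +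
            (C i i - (∑ k, C k k) / 3 * frameDelta i i) ^ 2 := le_add_of_nonneg_right (sq_nonneg _)
      _ ≤ ∑ j, ((A i j - (∑ k, A k k) / 3 * frameDelta i j) ^ 2 +
            (C i j - (∑ k, C k k) / 3 * frameDelta i j) ^ 2) :=
          Finset.single_le_sum (f := fun j ↦ (A i j - (∑ k, A k k) / 3 * frameDelta i j) ^ 2 +
            (C i j - (∑ k, C k k) / 3 * frameDelta i j) ^ 2)
            (fun j _ ↦ add_nonneg (sq_nonneg _) (sq_nonneg _)) (Finset.mem_univ i)
  simp only [Fin.sum_univ_three, frameDelta_self, mul_one] at hdiag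
  rw [htr]
  nlinarith [hdiag, sq_nonneg (A 1 1 - A 2 2)]

end WeylBlocks

/-! ### `(R − 3 K_iso(e))² ≤ 6 |W|²` for a metric, and two-sided bounds for `K_min` -/

section Pointwise

open Literature.Geometry.Lorentzian (PseudoRiemannianMetric)
open Literature.Geometry.Lorentzian.PseudoRiemannianMetric

variable {E : Type*} [NormedAddCommGroup E] [NormedSpace ℝ E] {H : Type*} [TopologicalSpace H]
  {I : ModelWithCorners ℝ E H} {M : Type*} [TopologicalSpace M] [ChartedSpace H M]
  [IsManifold I ∞ M] {n : ℕ∞ω}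
  (g : PseudoRiemannianMetric I n E (TangentSpace I : M → Type _))

variable [FiniteDimensional ℝ E] [g.HasLeviCivita] [Fact (1 ≤ n)] [CompleteSpace E]

/-- **`(R(x) − 3 K_iso(e))² ≤ 6 |W_g|²(x)` on every orthonormal `4`-frame** of a `C²` metric on a
`4`-dimensional model (Chen–Zhu 2014, §1 (p. 4) with Hamilton 1997, §1.2: `R − 3K(e) = 3Å₁₁(e)`,
`|W|² = ‖Å‖² + ‖C̊‖²` in the `(0,4)`-norm of Chang–Gursky–Yang, Remark 2, and
`Å₁₁² ≤ (2/3)(Å₁₁² + Å₂₂² + Å₃₃²)` for the trace-free `Å`).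
[cite: ChenZhu2014, §1, p. 4] [cite: Hamilton1997, §1.2, p. 5] -/
theorem sq_scalarCurvature_sub_three_mul_isotropicCurvature_le (hn : 2 ≤ n) (hE : finrank ℝ E = 4)
    {x : M} {e : Fin 4 → TangentSpace I x} (he : g.IsOrthonormalFrame x e) :
    (g.scalarCurvature x - 3 * g.isotropicCurvature g.leviCivita x e) ^ 2 ≤ 6 * g.weylNormSq x := by
  have hLC : g.IsLeviCivita g.leviCivita := isLeviCivita_leviCivita_holds
  set R : Fin 4 → Fin 4 → Fin 4 → Fin 4 → ℝ :=
    fun a b c d ↦ g.curvatureForm g.leviCivita x (e a) (e b) (e c) (e d) with hR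
  have h12 : ∀ a b c d, R a b c d = -R b a c d :=
    fun a b c d ↦ g.curvatureForm_antisymm g.leviCivita x (e a) (e b) (e c) (e d)
  have h34 : ∀ a b c d, R a b c d = -R a b d c :=
    fun a b c d ↦ g.curvatureForm_leviCivita_antisymm₃₄ hn x (e a) (e b) (e c) (e d)
  have hp : ∀ a b c d, R a b c d = R c d a b :=
    fun a b c d ↦ hLC.val_curvature_pair_symm hn x (e a) (e b) (e c) (e d)
  have hb : R 0 1 2 3 + R 1 2 0 3 + R 2 0 1 3 = 0 :=
    hLC.val_curvature_cyclic hn x (e 0) (e 1) (e 2) (e 3)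
  have key := WeylBlocks.sq_scalArr_sub_three_mul_iso_le R h12 h34 hp hb
  have hW : ∀ i j k l, g.weylFrame x e i j k l = WeylBlocks.weylArr R i j k l :=
    weylFrame_eq_weylArr g hE he
  have hS : WeylBlocks.scalArr R = g.scalarCurvature x := by
    simp only [WeylBlocks.scalArr, WeylBlocks.ricArr, hR, he.sum_curvatureForm_eq_ricci g hE,
      he.sum_ricci_eq_scalarCurvature g hE]
  have hK : R 0 2 2 0 + R 0 3 3 0 + R 1 2 2 1 + R 1 3 3 1 - 2 * R 0 1 3 2 =
      g.isotropicCurvature g.leviCivita x e := rfl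
  rw [g.weylNormSq_eq_weylNormSqFrame_four hE he, weylNormSqFrame]
  simp only [hW]
  rwa [hS, hK] at key

/-- **`R − √(6|W|²) ≤ 3 K_iso(e) ≤ R + √(6|W|²)`** on every orthonormal `4`-frame (square root of
`sq_scalarCurvature_sub_three_mul_isotropicCurvature_le`; Chen–Zhu 2014, §3: `σ_g = R_g −
6 max{λ_max(W₊), λ_max(W₋)}` bounds the isotropic curvatures, and `6λ_max ≤ √6 |W|`).
[cite: ChenZhu2014, §1 (p. 4) and §3] -/
theorem abs_scalarCurvature_sub_three_mul_isotropicCurvature_le (hn : 2 ≤ n) (hE : finrank ℝ E = 4)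
    {x : M} {e : Fin 4 → TangentSpace I x} (he : g.IsOrthonormalFrame x e) :
    |g.scalarCurvature x - 3 * g.isotropicCurvature g.leviCivita x e| ≤
      Real.sqrt (6 * g.weylNormSq x) :=
  Real.abs_le_sqrt (sq_scalarCurvature_sub_three_mul_isotropicCurvature_le g hn hE he)

/-- Lower bound: `(R − √(6|W|²))/3 ≤ K_iso(e)` on every orthonormal `4`-frame.
[cite: ChenZhu2014, §1 (p. 4) and §3] -/
theorem isotropicCurvature_ge_of_isOrthonormalFrame (hn : 2 ≤ n) (hE : finrank ℝ E = 4)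
    {x : M} {e : Fin 4 → TangentSpace I x} (he : g.IsOrthonormalFrame x e) :
    (g.scalarCurvature x - Real.sqrt (6 * g.weylNormSq x)) / 3 ≤
      g.isotropicCurvature g.leviCivita x e := by
  have h := (abs_le.1 (abs_scalarCurvature_sub_three_mul_isotropicCurvature_le g hn hE he)).2
  linarith

/-- Upper bound: `K_iso(e) ≤ (R + √(6|W|²))/3` on every orthonormal `4`-frame.
[cite: ChenZhu2014, §1 (p. 4) and §3] -/
theorem isotropicCurvature_le_of_isOrthonormalFrame (hn : 2 ≤ n) (hE : finrank ℝ E = 4)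
    {x : M} {e : Fin 4 → TangentSpace I x} (he : g.IsOrthonormalFrame x e) :
    g.isotropicCurvature g.leviCivita x e ≤
      (g.scalarCurvature x + Real.sqrt (6 * g.weylNormSq x)) / 3 := by
  have h := (abs_le.1 (abs_scalarCurvature_sub_three_mul_isotropicCurvature_le g hn hE he)).1
  linarith

end Pointwise

/-! ### Two-sided bounds for `K_min = minIsotropicCurvature` -/

section MinIso

open Lorentzian Lorentzian.PseudoRiemannianMetric

variable {M : Type*} [TopologicalSpace M] [ChartedSpace (EuclideanSpace ℝ (Fin 4)) M]
  [IsManifold (𝓡 4) ∞ M]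
  {G : PseudoRiemannianMetric (𝓡 4) ∞ (EuclideanSpace ℝ (Fin 4)) (TangentSpace (𝓡 4) : M → Type _)}
  [G.HasLeviCivita]

/-- **`R − √(6|W|²) ≤ 3 K_min`** pointwise on a Riemannian `4`-manifold (Chen–Zhu 2014, §3:
`σ_g = 3 K_min = R − 6 max{λ_max(W₊), λ_max(W₋)} ≥ R − √6 |W|`), through
`le_minIsotropicCurvature` of `NeumannIsotropicFormPos.lean`. [cite: ChenZhu2014, §3] -/
theorem scalarCurvature_sub_sqrt_le_minIsotropicCurvature (hG : G.IsRiemannian) (x : M) :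
    (G.scalarCurvature x - Real.sqrt (6 * G.weylNormSq x)) / 3 ≤ minIsotropicCurvature G x :=
  le_minIsotropicCurvature hG fun _ he ↦ isotropicCurvature_ge_of_isOrthonormalFrame G
    (WithTop.coe_le_coe.mpr le_top) finrank_euclideanSpace_fin he

/-- **`3 K_min ≤ R + √(6|W|²)`** pointwise on a Riemannian `4`-manifold (the bound at any one
orthonormal frame, `minIsotropicCurvature_le`). [cite: ChenZhu2014, §3] -/
theorem minIsotropicCurvature_le_scalarCurvature_add_sqrt (hG : G.IsRiemannian) (x : M) :
    minIsotropicCurvature G x ≤ (G.scalarCurvature x + Real.sqrt (6 * G.weylNormSq x)) / 3 := by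
  obtain ⟨e, he⟩ := exists_isOrthonormalFrame hG x
  exact (minIsotropicCurvature_le hG he).trans
    (isotropicCurvature_le_of_isOrthonormalFrame G (WithTop.coe_le_coe.mpr le_top)
      finrank_euclideanSpace_fin he)

end MinIso

/-! ### Conformal metrics `u² G` and the Yamabe bound `Y √(∫u⁴) ≤ ∫ R u² + 6 ∫ |du|²` -/

section Conformal

open Lorentzian Lorentzian.PseudoRiemannianMetric

variable {M : Type*} [TopologicalSpace M] [ChartedSpace (EuclideanSpace ℝ (Fin 4)) M]
  [IsManifold (𝓡 4) ∞ M]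
  (G : PseudoRiemannianMetric (𝓡 4) ∞ (EuclideanSpace ℝ (Fin 4)) (TangentSpace (𝓡 4) : M → Type _))

/-- **The conformal metric `u² G`** of a Riemannian `C^∞` metric `G` and a smooth positive
function `u` is a Riemannian `C^∞` metric (`PseudoRiemannianMetric.confSmul` of `CkNecks.lean`);
Chen–Zhu 2014, §2: the conformal class `𝒞_g = {ρ g ∣ ρ > 0}`, `ĝ = u^{4/(n−2)} g = u² g` for
`n = 4`. Packaged as an existence statement so that the metric is an opaque witness downstream.
[cite: ChenZhu2014, §2, (2.8)] -/
theorem exists_conformal_sq (hG : G.IsRiemannian) {u : M → ℝ}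
    (hu : ContMDiff (𝓡 4) 𝓘(ℝ) ∞ u) (hpos : ∀ x, 0 < u x) :
    ∃ G' : PseudoRiemannianMetric (𝓡 4) ∞ (EuclideanSpace ℝ (Fin 4)) (TangentSpace (𝓡 4) : M → Type _),
      G'.IsRiemannian ∧
        ∀ (x : M) (v w : TangentSpace (𝓡 4) x), G'.val x v w = u x ^ 2 * G.val x v w := by
  have h2 : ContMDiff (𝓡 4) 𝓘(ℝ) ∞ (fun x ↦ u x ^ 2) := (contDiff_id.pow 2).comp_contMDiff hu
  have h2pos : ∀ x, 0 < u x ^ 2 := fun x ↦ pow_pos (hpos x) 2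
  exact ⟨G.confSmul (fun x ↦ u x ^ 2) h2 (fun x ↦ (h2pos x).ne'), hG.confSmul h2 h2pos,
    fun x v w ↦ confSmul_apply G _ h2 _ x v w⟩

variable [G.HasLeviCivita] [T2Space M] [SecondCountableTopology M] [CompactSpace M]
  [MeasurableSpace M] [BorelSpace M]

/-- **`Y(M,[G]) √(∫u⁴ dV_G) ≤ ∫ R_G u² dV_G + 6 ∫ G⁻¹(du,du) dV_G`** for every smooth positive `u`
on a closed `4`-manifold, as soon as `Y(M,[G]) > 0`: the conformal metric `h = u² G` belongs to
the class, `Y ≤ Q(h)` by definition of the infimum, and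
`Q(h) = (∫R_G u² + 6∫|du|²_G)/(∫u⁴)^{1/2}` (`totalScalarCurvature_conformal_sq`; Aubin 1982,
Ch. 6, §6.4: `J(φψ) = J'(ψ)`; Chen–Zhu 2014, (2.8) with `f = 0`, `n = 4`).
[cite: ChenZhu2014, §2, (2.8)] [cite: Aubin1982, Ch. 6, §6.4] -/
theorem yamabeConstant_mul_sqrt_le (hG : G.IsRiemannian) {u : M → ℝ}
    (hu : ContMDiff (𝓡 4) 𝓘(ℝ) ∞ u) (hpos : ∀ x, 0 < u x)
    (hY : 0 < yamabeConstant (G.toContMDiffRiemannianMetric hG)) :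
    yamabeConstant (G.toContMDiffRiemannianMetric hG) *
        Real.sqrt (∫ x, u x ^ 4 ∂(riemannianMeasure (G.toContMDiffRiemannianMetric hG))) ≤
      ∫ x, G.scalarCurvature x * u x ^ 2 ∂(riemannianMeasure (G.toContMDiffRiemannianMetric hG)) +
        6 * ∫ x, G.innerDual x (mvfderiv (𝓡 4) u x).toLinearMap (mvfderiv (𝓡 4) u x).toLinearMap
          ∂(riemannianMeasure (G.toContMDiffRiemannianMetric hG)) := by
  haveI hLC : (ofRiemannian (G.toContMDiffRiemannianMetric hG)).HasLeviCivita := ‹G.HasLeviCivita›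
  have hE : finrank ℝ (EuclideanSpace ℝ (Fin 4)) = 4 := finrank_euclideanSpace_fin
  obtain ⟨G', hG'R, hval⟩ := exists_conformal_sq G hG hu hpos
  haveI hLC' : G'.HasLeviCivita := G'.hasLeviCivita
  haveI hLC'' : (ofRiemannian (G'.toContMDiffRiemannianMetric hG'R)).HasLeviCivita := hLC'
  have hconf : IsConformalTo (G'.toContMDiffRiemannianMetric hG'R)
      (G.toContMDiffRiemannianMetric hG) :=
    ⟨fun x ↦ u x ^ 2, fun x ↦ ⟨pow_pos (hpos x) 2, fun v w ↦ hval x v w⟩⟩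
  have hbdd : BddBelow (yamabeQuotients (G.toContMDiffRiemannianMetric hG)) := by
    by_contra hnb
    rw [yamabeConstant, Real.sInf_of_not_bddBelow hnb] at hY
    exact lt_irrefl _ hY
  have hYQ : yamabeConstant (G.toContMDiffRiemannianMetric hG) ≤
      yamabeQuotient (G'.toContMDiffRiemannianMetric hG'R) :=
    yamabeConstant_le hbdd _ hconf
  obtain ⟨hT, hV⟩ := totalScalarCurvature_conformal_sq G hG (G'.toContMDiffRiemannianMetric hG'R)
    hu hpos hval
  rw [yamabeQuotient_eq_div_sqrt hE (G'.toContMDiffRiemannianMetric hG'R), hV, hT] at hYQ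
  have hsq0 : 0 ≤ Real.sqrt (∫ x, u x ^ 4 ∂riemannianMeasure (G.toContMDiffRiemannianMetric hG)) :=
    Real.sqrt_nonneg _
  rcases hsq0.eq_or_lt with h0 | hpos'
  · rw [← h0, div_zero] at hYQ
    exact absurd hYQ (not_le.2 hY)
  · exact (le_div_iff₀ hpos').1 hYQ

/-! ### The bridge: `Y > 0` and `6∫|W|² < Y²` make the isotropic Yamabe form coercive -/

/-- **Chen–Zhu 2014, §1 (p. 4) with Lemma 2.3 and Remark 1.8, in the special case needed here:
positivity of the isotropic Yamabe form.** On a closed `4`-manifold with a `C^∞` Riemannian metric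
`G`, if `Y(M,[G]) > 0` and `6 ∫|W_G|² dV_G < Y(M,[G])²` (`(0,4)`-norm of Chang–Gursky–Yang,
Remark 2), then for every smooth `u > 0`,
`(Y − √(6∫|W|²)) (∫u⁴)^{1/2} ≤ ∫ (6 G⁻¹(du,du) + 3 K_min u²) dV_G` — the hypothesis of the named
fact `chenZhu2014_conformal_pic_four` (`𝒴_f(M⁴, 𝒞_G) > 0` for `f(W) = R − 3K_min =
6 max{λ_max(W₊), λ_max(W₋)}`). Proof: `3K_min ≥ R − √(6|W|²)` pointwise
(`scalarCurvature_sub_sqrt_le_minIsotropicCurvature`), `∫(6|du|² + Ru²) ≥ Y‖u‖₄²`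
(`yamabeConstant_mul_sqrt_le`), continuity of `K_min` (`continuous_minIsotropicCurvature`,
`NeumannIsotropicFormPos.lean`) for the integrability of the form, and
Hölder `∫√(6|W|²) u² ≤ (6∫|W|²)^{1/2} ‖u‖₄²`. [cite: ChenZhu2014, §1 (p. 4), Lemma 2.3, Remark 1.8] -/
theorem isotropicYamabe_coercive_of_weylEnergy_lt (hG : G.IsRiemannian)
    (hY : 0 < yamabeConstant (G.toContMDiffRiemannianMetric hG))
    (hW : 6 * G.weylEnergy.toReal < yamabeConstant (G.toContMDiffRiemannianMetric hG) ^ 2) :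
    ∃ c : ℝ, 0 < c ∧ ∀ u : M → ℝ, ContMDiff (𝓡 4) 𝓘(ℝ, ℝ) ∞ u → (∀ x, 0 < u x) →
      c * Real.sqrt (∫ x, u x ^ 4 ∂(riemannianMeasure (G.toContMDiffRiemannianMetric hG))) ≤
        ∫ x, (6 * G.gradSq u x + 3 * minIsotropicCurvature G x * u x ^ 2)
          ∂(riemannianMeasure (G.toContMDiffRiemannianMetric hG)) := by
  set G₀ := G.toContMDiffRiemannianMetric hG with hG₀
  set μ : Measure M := riemannianMeasure G₀ with hμ
  haveI : IsFiniteMeasure μ := isFiniteMeasure_riemannianMeasure G₀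
  have hE : finrank ℝ (EuclideanSpace ℝ (Fin 4)) = 4 := finrank_euclideanSpace_fin
  set Y := yamabeConstant G₀ with hYdef
  set Wr : ℝ := G.weylEnergy.toReal with hWr
  have hWr0 : 0 ≤ Wr := ENNReal.toReal_nonneg
  set c : ℝ := Y - Real.sqrt (6 * Wr) with hc
  have hcpos : 0 < c := by
    have : Real.sqrt (6 * Wr) < Y := (Real.sqrt_lt' hY).2 hW
    rw [hc]; linarith
  refine ⟨c, hcpos, fun u hu hupos ↦ ?_⟩
  -- continuity of the players
  have hRc : Continuous G.scalarCurvature := G.contMDiff_scalarCurvature.continuous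
  have hWc : Continuous G.weylNormSq := G.continuous_weylNormSq hG hE
  have huc : Continuous u := hu.continuous
  have hu1 : ContMDiff (𝓡 4) 𝓘(ℝ, ℝ) 1 u := hu.of_le (by exact_mod_cast le_top)
  have hIc : Continuous fun x ↦
      G.innerDual x (mvfderiv (𝓡 4) u x).toLinearMap (mvfderiv (𝓡 4) u x).toLinearMap :=
    continuous_innerDual_mvfderiv G hu1 hu1
  have hgradc : Continuous fun x ↦ G.gradSq u x := hIc
  have hsqc : Continuous fun x ↦ Real.sqrt (6 * G.weylNormSq x) := (hWc.const_mul 6).sqrt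
  -- `K_min` is continuous (`continuous_minIsotropicCurvature`), hence `3 K_min u²` is integrable
  have hKc : Continuous (minIsotropicCurvature G) := continuous_minIsotropicCurvature hG
  have hint_K : Integrable (fun x ↦ 3 * minIsotropicCurvature G x * u x ^ 2) μ :=
    integrable_of_continuous G₀ ((continuous_const.mul hKc).mul (huc.pow 2))
  have hint_grad : Integrable (fun x ↦ 6 * G.gradSq u x) μ :=
    (integrable_of_continuous G₀ hgradc).const_mul 6
  have hint_Ru : Integrable (fun x ↦ G.scalarCurvature x * u x ^ 2) μ :=
    integrable_of_continuous G₀ (hRc.mul (huc.pow 2))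
  have hint_su : Integrable (fun x ↦ Real.sqrt (6 * G.weylNormSq x) * u x ^ 2) μ :=
    integrable_of_continuous G₀ (hsqc.mul (huc.pow 2))
  -- (1) split the form
  have hsplit : ∫ x, (6 * G.gradSq u x + 3 * minIsotropicCurvature G x * u x ^ 2) ∂μ =
      6 * ∫ x, G.gradSq u x ∂μ + ∫ x, 3 * minIsotropicCurvature G x * u x ^ 2 ∂μ := by
    rw [integral_add hint_grad hint_K, integral_const_mul]
  -- (2) `∫ 3 K_min u² ≥ ∫ R u² − ∫ √(6|W|²) u²`
  have hKge : ∫ x, G.scalarCurvature x * u x ^ 2 ∂μ - ∫ x, Real.sqrt (6 * G.weylNormSq x) * u x ^ 2 ∂μ ≤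
      ∫ x, 3 * minIsotropicCurvature G x * u x ^ 2 ∂μ := by
    rw [← integral_sub hint_Ru hint_su]
    refine integral_mono (hint_Ru.sub hint_su) hint_K fun x ↦ ?_
    have h := scalarCurvature_sub_sqrt_le_minIsotropicCurvature hG x
    have hu2 : 0 ≤ u x ^ 2 := sq_nonneg _
    have : (G.scalarCurvature x - Real.sqrt (6 * G.weylNormSq x)) * u x ^ 2 ≤
        3 * minIsotropicCurvature G x * u x ^ 2 := by
      apply mul_le_mul_of_nonneg_right _ hu2
      linarith
    simpa [sub_mul] using this
  -- (3) Yamabe: `Y √(∫u⁴) ≤ ∫ R u² + 6 ∫ |du|²`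
  have hYam := yamabeConstant_mul_sqrt_le G hG hu hupos hY
  -- (4) Hölder: `∫ √(6|W|²) u² ≤ √(6 Wr) √(∫ u⁴)`
  have hWint := G.weylEnergy_eq_ofReal_integral hG hE
  have hWr_eq : Wr = ∫ x, G.weylNormSq x ∂μ := by
    rw [hWr, hWint.2, ENNReal.toReal_ofReal (integral_nonneg fun x ↦ G.weylNormSq_nonneg x)]
  have hHolder : ∫ x, Real.sqrt (6 * G.weylNormSq x) * u x ^ 2 ∂μ ≤
      Real.sqrt (6 * Wr) * Real.sqrt (∫ x, u x ^ 4 ∂μ) := by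
    have hf : MemLp (fun x ↦ Real.sqrt (6 * G.weylNormSq x)) (ENNReal.ofReal 2) μ :=
      ⟨hsqc.aestronglyMeasurable, eLpNorm_lt_top_of_continuous hsqc _⟩
    have hg : MemLp (fun x ↦ u x ^ 2) (ENNReal.ofReal 2) μ :=
      ⟨(huc.pow 2).aestronglyMeasurable, eLpNorm_lt_top_of_continuous (huc.pow 2) _⟩
    have h := integral_mul_le_Lp_mul_Lq_of_nonneg Real.HolderConjugate.two_two
      (ae_of_all _ fun x ↦ Real.sqrt_nonneg _) (ae_of_all _ fun x ↦ sq_nonneg (u x)) hf hg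
    have h1 : ∫ x, Real.sqrt (6 * G.weylNormSq x) ^ (2 : ℝ) ∂μ = 6 * Wr := by
      rw [hWr_eq, ← integral_const_mul]
      refine integral_congr_ae (Eventually.of_forall fun x ↦ ?_)
      simp only [Real.rpow_two]
      rw [Real.sq_sqrt (by have := G.weylNormSq_nonneg x; positivity)]
    have h2 : ∫ x, (u x ^ 2) ^ (2 : ℝ) ∂μ = ∫ x, u x ^ 4 ∂μ := by
      refine integral_congr_ae (Eventually.of_forall fun x ↦ ?_)
      simp only [Real.rpow_two]
      ring
    rw [h1, h2, ← Real.sqrt_eq_rpow, ← Real.sqrt_eq_rpow] at h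
    exact h
  -- (5) combine
  have hsqrt0 : 0 ≤ Real.sqrt (∫ x, u x ^ 4 ∂μ) := Real.sqrt_nonneg _
  have hgrad_eq : ∫ x, G.gradSq u x ∂μ =
      ∫ x, G.innerDual x (mvfderiv (𝓡 4) u x).toLinearMap (mvfderiv (𝓡 4) u x).toLinearMap ∂μ := rfl
  rw [hsplit, hgrad_eq, hc, sub_mul]
  linarith [hKge, hYam, hHolder]

end Conformal

/-! ### The large-Yamabe sphere theorem through positive isotropic curvature -/

section Sphere

open Lorentzian Lorentzian.PseudoRiemannianMetric

/-- **The PIC line, elementary regime (Chen–Zhu 2014, Thm. 1.4 in the simply connected case, in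
the `(0,4)`-Weyl-norm form of their p. 4): `Y(M,[G]) > 0` and `6∫|W_G|² dV_G < Y(M,[G])²` on a
closed simply connected `4`-manifold force `M ≅ S⁴`** — GIVEN the two named facts of the tree it
runs through: Chen–Zhu's Cor. 2.2/§3 (`chenZhu2014_conformal_pic_four`: a positive isotropic
Yamabe constant yields a conformal metric of positive isotropic curvature; here fed by
`isotropicYamabe_coercive_of_weylEnergy_lt`) and Hamilton's PIC sphere theorem
(`hamilton_pic_sphere_four`: Hamilton 1997, Cor. 1.2 (a), completed by Chen–Zhu 2006 /
Chen–Tang–Zhu 2012). [cite: ChenZhu2014, Thm. 1.4 and §1 (p. 4)]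
[cite: Hamilton1997, Cor. 1.2(a) (p. 3) of Thm. 1.1 (p. 2)] -/
theorem sphere_of_weylEnergy_lt_yamabe_sq (hCZ : chenZhu2014_conformal_pic_four)
    (hPIC : hamilton_pic_sphere_four)
    (M : Type) [TopologicalSpace M] [T2Space M] [SecondCountableTopology M]
    [ChartedSpace (EuclideanSpace ℝ (Fin 4)) M] [IsManifold (𝓡 4) ∞ M] [CompactSpace M]
    [SimplyConnectedSpace M] [MeasurableSpace M] [BorelSpace M]
    (G : PseudoRiemannianMetric (𝓡 4) ∞ (EuclideanSpace ℝ (Fin 4)) (TangentSpace (𝓡 4) : M → Type _))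
    [G.HasLeviCivita] (hG : G.IsRiemannian)
    (hY : 0 < yamabeConstant (G.toContMDiffRiemannianMetric hG))
    (hW : 6 * G.weylEnergy.toReal < yamabeConstant (G.toContMDiffRiemannianMetric hG) ^ 2) :
    Nonempty (M ≃ₘ⟮𝓡 4, 𝓡 4⟯ Metric.sphere (0 : EuclideanSpace ℝ (Fin 5)) 1) := by
  obtain ⟨c, hc, hcoer⟩ := isotropicYamabe_coercive_of_weylEnergy_lt G hG hY hW
  obtain ⟨G', u, -, -, hG'R, hG'P⟩ := hCZ M G hG ⟨c, hc, hcoer⟩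
  exact hPIC M ⟨G', hG'R, hG'P⟩

end Sphere

/-! ### Chang–Gursky–Yang's Theorem A (vended special case) along the PIC line -/

section Reduction

open Lorentzian Lorentzian.PseudoRiemannianMetric

/-- **`changGurskyYang_sphere_four` from the PIC line** — Chen–Zhu 2014, p. 4, "Theorem 1.2
[= Chang–Gursky–Yang's Thm. A] can be deduced from Theorem 1.4", specialised to the vended
simply connected `scal > 0` case and assembled from: the two NAMED FACTS of the tree the line runs
through — `hCZ : chenZhu2014_conformal_pic_four` (Chen–Zhu 2014, Cor. 2.2 with §3 ¶1: a positive
isotropic Yamabe constant gives a conformal metric of positive isotropic curvature; the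
"semi-linear" step replacing the fully nonlinear PDE of [CGY1]) and
`hPIC : hamilton_pic_sphere_four` (Hamilton 1997, Cor. 1.2 (a) / Chen–Zhu 2006 / Chen–Tang–Zhu 2012:
a closed simply connected PIC `4`-manifold is `≅ S⁴`; replacing Margerin's weak-pinching theorem) —
and three classical inputs stated verbatim as hypotheses:
* `hCGB` — THE CHERN–GAUSS–BONNET FORMULA WITH `χ(M) ≥ 2` for closed simply connected `M`
  (Chang–Gursky–Yang 2003, (0.4)/(1.1): `8π²χ = ¼∫|W|² + ∫σ₂(A)`; `χ = 2 + b₂ ≥ 2`, Hatcher 2002,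
  Thm. 3.30) — the same hypothesis, verbatim, as in
  `changGurskyYang_sphere_four_of_margerin_of_yamabe_of_chernGaussBonnet_of_thm14`;
* `hAubin` — THE YAMABE PROBLEM BELOW THE SPHERE CONSTANT (Lee–Parker 1987, Thm. A (Yamabe,
  Trudinger, Aubin), p. 39: "The Yamabe problem can be solved on any compact manifold `M` with
  `λ(M) < λ(Sⁿ)`", with Thm. 4.5, p. 55: "a positive function `φ ∈ C^∞(M)` which satisfies
  `Q_g(φ) = λ(M)` … Thus the metric `g̃ = φ^{p−2} g` has constant scalar curvature `λ(M)`", and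
  Thm. 3.3, p. 50: `λ(Sⁿ) = n(n−1) vol(Sⁿ)^{2/n}`, i.e. `λ(S⁴) = 12 (8π²/3)^{1/2} = 8√6 π`;
  `p − 2 = 2` for `n = 4`): if `Y(M,[g]) < 8√6π` there is a conformal metric `g' = ψ² g`, `ψ > 0`
  smooth, of constant scalar curvature attaining the Yamabe constant, `∫R_{g'} dV_{g'} =
  Y(M,[g]) √Vol(g')` (`Q(g') = Y`, the metric form of `Q_g(φ) = λ(M)`, Lee–Parker (1.4)–(1.5));
* `hWeylConf` — CONFORMAL INVARIANCE OF THE WEYL ENERGY IN DIMENSION FOUR (Besse 1987, Thm. 1.159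
  (b)–(c): `W^{g'} = e^{2f} W^{g}` for `g' = e^{2f} g`, so `|W_{g'}|²_{g'} dV_{g'} = |W_g|²_g dV_g` for
  `n = 4`; Chang–Gursky–Yang 2003, p. 111 and Chen–Zhu 2014, p. 3: "the condition (ii) is invariant
  under conformal change of the metric").

Proof (Chen–Zhu 2014, p. 4, in the `(0,4)`-norm `|W|² = 4(|W₊|² + |W₋|²)` of Chang–Gursky–Yang,
Remark 2). `Y = Y(M,[g]) > 0` since `scal_g > 0` (`yamabeConstant_pos_of_scalarCurvature_pos`,
proved in `YamabePositivity.lean`). If `6∫|W_g|² < Y²`, `sphere_of_weylEnergy_lt_yamabe_sq` (the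
bridge `isotropicYamabe_coercive_of_weylEnergy_lt` — `3K_min ≥ R − √6|W|` pointwise, i.e.
Chen–Zhu's `|W±|² ≥ (3/2)λ_max²`, and Hölder — then `hCZ`, then `hPIC`) concludes. Otherwise
`Y² ≤ 6∫|W_g|² < 192π² < (8√6π)²`, so `hAubin` gives the Yamabe metric `g' = ψ²g` with `R_{g'} ≡ R₀`
and `Y = R₀ √V'`, `V' = Vol(g')`; by `hWeylConf`, `∫|W_{g'}|² = ∫|W_g|² < 32π²`; by `hCGB` for `g'`,
`∫σ₂(A_{g'}) = 8π²χ − ¼∫|W_{g'}|² ≥ 16π² − ¼∫|W_{g'}|² > ¼∫|W_{g'}|²`; and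
`σ₂(A) = R₀²/24 − ½|E|² ≤ R₀²/24` (`sigma2WeylSchouten_eq`), so `¼∫|W_{g'}|² < R₀² V'/24`, i.e.
`6∫|W_{g'}|² < R₀² V' = Y² = Y(M,[g'])²` (`yamabeConstant_eq_of_isConformalTo`) — the elementary
regime for `g'`, and `sphere_of_weylEnergy_lt_yamabe_sq` concludes again. No hypothesis is a new
named fact; `hCZ`, `hPIC` are existing named facts of the tree, `hCGB`, `hAubin`, `hWeylConf` are
published theorems recorded as the exact remaining proof debt of this line.
[cite: ChenZhu2014, §1, p. 4 (Thm. 1.2 from Thm. 1.4)] [cite: ChangGurskyYang2003, Thm. A, (0.4), (1.1)]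
[cite: LeeParker1987, Thm. A (p. 39), Thm. 4.5 (p. 55), Thm. 3.3 (p. 50)]
[cite: Besse1987, Thm. 1.159 (b)–(c)] [cite: Hamilton1997, Cor. 1.2(a) (p. 3) of Thm. 1.1 (p. 2)]
[cite: Hatcher2002, Thm. 3.30] -/
theorem changGurskyYang_sphere_four_of_pic_of_chenZhu_of_chernGaussBonnet_of_aubin_of_weylConformal
    (hPIC : hamilton_pic_sphere_four) (hCZ : chenZhu2014_conformal_pic_four)
    (hCGB : ∀ (M : Type) [TopologicalSpace M] [T2Space M] [SecondCountableTopology M]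
      [ChartedSpace (EuclideanSpace ℝ (Fin 4)) M] [IsManifold (𝓡 4) ∞ M] [CompactSpace M]
      [SimplyConnectedSpace M]
      (g : PseudoRiemannianMetric (𝓡 4) ∞ (EuclideanSpace ℝ (Fin 4)) (TangentSpace (𝓡 4) : M → Type _))
      [g.HasLeviCivita], g.IsRiemannian →
      ∃ χ : ℕ, 2 ≤ χ ∧
        8 * Real.pi ^ 2 * χ = 1 / 4 * g.weylEnergy.toReal + g.sigma2WeylSchoutenIntegral)
    (hAubin : ∀ (M : Type) [TopologicalSpace M] [T2Space M] [SecondCountableTopology M]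
      [ChartedSpace (EuclideanSpace ℝ (Fin 4)) M] [IsManifold (𝓡 4) ∞ M] [CompactSpace M]
      [ConnectedSpace M] [MeasurableSpace M] [BorelSpace M]
      (g : PseudoRiemannianMetric (𝓡 4) ∞ (EuclideanSpace ℝ (Fin 4)) (TangentSpace (𝓡 4) : M → Type _))
      [g.HasLeviCivita] (hg : g.IsRiemannian),
      yamabeConstant (g.toContMDiffRiemannianMetric hg) < 8 * Real.sqrt 6 * Real.pi →
      ∃ (ψ : M → ℝ)
        (g' : PseudoRiemannianMetric (𝓡 4) ∞ (EuclideanSpace ℝ (Fin 4)) (TangentSpace (𝓡 4) : M → Type _))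
        (_ : g'.HasLeviCivita) (hg' : g'.IsRiemannian),
        ContMDiff (𝓡 4) 𝓘(ℝ) ∞ ψ ∧ (∀ x, 0 < ψ x) ∧
        (∀ (x : M) (v w : TangentSpace (𝓡 4) x), g'.val x v w = ψ x ^ 2 * g.val x v w) ∧
        (∃ R₀ : ℝ, ∀ x, g'.scalarCurvature x = R₀) ∧
        ∫ x, g'.scalarCurvature x ∂(riemannianMeasure (g'.toContMDiffRiemannianMetric hg')) =
          yamabeConstant (g.toContMDiffRiemannianMetric hg) *
            Real.sqrt (riemannianMeasure (g'.toContMDiffRiemannianMetric hg') Set.univ).toReal)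
    (hWeylConf : ∀ (M : Type) [TopologicalSpace M] [T2Space M] [SecondCountableTopology M]
      [ChartedSpace (EuclideanSpace ℝ (Fin 4)) M] [IsManifold (𝓡 4) ∞ M] [CompactSpace M]
      (g g' : PseudoRiemannianMetric (𝓡 4) ∞ (EuclideanSpace ℝ (Fin 4)) (TangentSpace (𝓡 4) : M → Type _))
      [g.HasLeviCivita] [g'.HasLeviCivita], g.IsRiemannian → ∀ (ψ : M → ℝ),
      ContMDiff (𝓡 4) 𝓘(ℝ) ∞ ψ → (∀ x, 0 < ψ x) →
      (∀ (x : M) (v w : TangentSpace (𝓡 4) x), g'.val x v w = ψ x ^ 2 * g.val x v w) →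
      g'.weylEnergy = g.weylEnergy) :
    changGurskyYang_sphere_four := by
  intro M _ _ _ _ _ _ _ hM
  obtain ⟨g, _, hgR, hscal, hW⟩ := hM
  letI : MeasurableSpace M := borel M
  haveI : BorelSpace M := ⟨rfl⟩
  have hE : finrank ℝ (EuclideanSpace ℝ (Fin 4)) = 4 := finrank_euclideanSpace_fin
  have hn2 : (2 : ℕ∞ω) ≤ ((⊤ : ℕ∞) : ℕ∞ω) := WithTop.coe_le_coe.mpr le_top
  have hπ : 0 < Real.pi ^ 2 := by positivity
  -- (i) `Y(M,[g]) > 0` since `scal_g > 0`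
  have hY : 0 < yamabeConstant (g.toContMDiffRiemannianMetric hgR) :=
    yamabeConstant_pos_of_scalarCurvature_pos g hgR hscal
  -- the Weyl energy as a real number `< 32π²`
  have hWr : g.weylEnergy.toReal < 32 * Real.pi ^ 2 :=
    (ENNReal.lt_ofReal_iff_toReal_lt (g.weylEnergy_lt_top hgR).ne).1 hW
  by_cases hcase : 6 * g.weylEnergy.toReal < yamabeConstant (g.toContMDiffRiemannianMetric hgR) ^ 2
  · -- elementary regime
    exact sphere_of_weylEnergy_lt_yamabe_sq hCZ hPIC M g hgR hY hcase
  · -- `Y² ≤ 6∫|W|² < 192π² < (8√6π)²`: pass to the Yamabe metric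
    push Not at hcase
    have hYlt : yamabeConstant (g.toContMDiffRiemannianMetric hgR) < 8 * Real.sqrt 6 * Real.pi := by
      have h6 : Real.sqrt 6 ^ 2 = 6 := Real.sq_sqrt (by norm_num)
      have hsq : yamabeConstant (g.toContMDiffRiemannianMetric hgR) ^ 2 <
          (8 * Real.sqrt 6 * Real.pi) ^ 2 := by
        rw [mul_pow, mul_pow, h6]
        have h0 : 0 ≤ g.weylEnergy.toReal := ENNReal.toReal_nonneg
        nlinarith
      exact lt_of_pow_lt_pow_left₀ 2 (by positivity) hsq
    obtain ⟨ψ, g', hLC', hg'R, hψ, hψpos, hconf, ⟨R₀, hR₀⟩, hQ⟩ := hAubin M g hgR hYlt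
    -- the conformal class and the Yamabe constant of `g'`
    have hconf' : IsConformalTo (g'.toContMDiffRiemannianMetric hg'R)
        (g.toContMDiffRiemannianMetric hgR) :=
      ⟨fun x ↦ ψ x ^ 2, fun x ↦ ⟨pow_pos (hψpos x) 2, fun v w ↦ hconf x v w⟩⟩
    have hYeq : yamabeConstant (g'.toContMDiffRiemannianMetric hg'R) =
        yamabeConstant (g.toContMDiffRiemannianMetric hgR) :=
      yamabeConstant_eq_of_isConformalTo hconf'
    -- the volume of `g'`
    set μ' : Measure M := riemannianMeasure (g'.toContMDiffRiemannianMetric hg'R) with hμ'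
    set V' : ℝ := (μ' Set.univ).toReal with hV'
    haveI : IsFiniteMeasure μ' := isFiniteMeasure_riemannianMeasure (g'.toContMDiffRiemannianMetric hg'R)
    have hV'pos : 0 < V' := by
      refine ENNReal.toReal_pos ?_ ?_
      · haveI := isOpenPosMeasure_riemannianMeasure (I := 𝓡 4) (g'.toContMDiffRiemannianMetric hg'R)
        exact (isOpen_univ.measure_pos μ' univ_nonempty).ne'
      · exact (riemannianVolume_lt_top_of_isCompact_holds (g'.toContMDiffRiemannianMetric hg'R)
          le_rfl isCompact_univ).ne
    -- `Y √V' = ∫ R₀ dV' = R₀ V'`, hence `Y² = R₀² V'`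
    have hint : ∫ x, g'.scalarCurvature x ∂μ' = R₀ * V' := by
      simp_rw [hR₀]
      rw [integral_const, smul_eq_mul, measureReal_def, mul_comm]
    have hYR : yamabeConstant (g.toContMDiffRiemannianMetric hgR) * Real.sqrt V' = R₀ * V' := by
      rw [← hint]; exact hQ.symm
    have hYsq : yamabeConstant (g.toContMDiffRiemannianMetric hgR) ^ 2 = R₀ ^ 2 * V' := by
      have h1 := congrArg (fun t : ℝ ↦ t ^ 2) hYR
      simp only [mul_pow, Real.sq_sqrt hV'pos.le] at h1
      have hV'ne : V' ≠ 0 := hV'pos.ne'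
      field_simp at h1
      nlinarith [h1, hV'pos]
    -- the Weyl energy of `g'`
    have hWeq : g'.weylEnergy = g.weylEnergy := hWeylConf M g g' hgR ψ hψ hψpos hconf
    have hW'r : g'.weylEnergy.toReal < 32 * Real.pi ^ 2 := by rw [hWeq]; exact hWr
    -- Chern–Gauss–Bonnet for `g'`: `∫σ₂(A_{g'}) > ¼∫|W_{g'}|²`
    obtain ⟨χ, hχ, hCGBχ⟩ := hCGB M g' hg'R
    have hχ' : (2 : ℝ) ≤ χ := by exact_mod_cast hχ
    -- `∫σ₂(A_{g'}) ≤ R₀² V'/24`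
    have hS2 : g'.sigma2WeylSchoutenIntegral ≤ R₀ ^ 2 / 24 * V' := by
      rw [g'.sigma2WeylSchoutenIntegral_eq hg'R]
      calc ∫ x, g'.sigma2WeylSchouten x ∂μ'
          ≤ ∫ x, (fun _ ↦ R₀ ^ 2 / 24) x ∂μ' := by
            refine integral_mono (g'.integrable_sigma2WeylSchouten hg'R hE) (integrable_const _)
              fun x ↦ ?_
            have hpos' : ∀ v : TangentSpace (𝓡 4) x, v ≠ 0 → 0 < g'.val x v v := hg'R x
            rw [g'.sigma2WeylSchouten_eq hn2 hE hpos', hR₀ x]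
            have := g'.tracelessRicciNormSq_nonneg x
            show -(1 / 2) * g'.tracelessRicciNormSq x + R₀ ^ 2 / 24 ≤ R₀ ^ 2 / 24
            linarith
        _ = R₀ ^ 2 / 24 * V' := by
            rw [integral_const, smul_eq_mul, measureReal_def, mul_comm]
    -- hence `6∫|W_{g'}|² < R₀² V' = Y(M,[g'])²`
    have h6 : 6 * g'.weylEnergy.toReal < yamabeConstant (g'.toContMDiffRiemannianMetric hg'R) ^ 2 := by
      rw [hYeq, hYsq]
      nlinarith [hCGBχ, hχ', hS2, hW'r, hπ]
    have hY' : 0 < yamabeConstant (g'.toContMDiffRiemannianMetric hg'R) := by rw [hYeq]; exact hY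
    exact sphere_of_weylEnergy_lt_yamabe_sq hCZ hPIC M g' hg'R hY' h6

/-- **`changGurskyYang_sphere_four` along the PIC line, conformal invariance discharged.** As
`changGurskyYang_sphere_four_of_pic_of_chenZhu_of_chernGaussBonnet_of_aubin_of_weylConformal`, with
its hypothesis `hWeylConf` — the conformal invariance `∫|W_{ψ²g}|² dV_{ψ²g} = ∫|W_g|² dV_g` of the
Weyl energy of closed `4`-manifolds (Besse 1987, Thm. 1.159 (c); Chang–Gursky–Yang 2003, p. 111) —
supplied by the theorem `PseudoRiemannianMetric.weylEnergy_conformal_sq_four`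
(`Lorentzian/WeylConformal.lean`, proved; the Borel σ-algebra is chosen inside, the Weyl energy
being independent of it). Remaining hypotheses: the named facts `hamilton_pic_sphere_four` and
`chenZhu2014_conformal_pic_four`, Chern–Gauss–Bonnet with `χ(M) ≥ 2` (`hCGB`), and the Yamabe
problem below `λ(S⁴) = 8√6π` (`hAubin`, Lee–Parker 1987, Thm. A / Thm. 4.5).
[cite: ChenZhu2014, §1, p. 4 (Thm. 1.2 from Thm. 1.4)] [cite: Besse1987, Thm. 1.159 (c)]
[cite: LeeParker1987, Thm. A (p. 39), Thm. 4.5 (p. 55)] -/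
theorem changGurskyYang_sphere_four_of_pic_of_chenZhu_of_chernGaussBonnet_of_aubin
    (hPIC : hamilton_pic_sphere_four) (hCZ : chenZhu2014_conformal_pic_four)
    (hCGB : ∀ (M : Type) [TopologicalSpace M] [T2Space M] [SecondCountableTopology M]
      [ChartedSpace (EuclideanSpace ℝ (Fin 4)) M] [IsManifold (𝓡 4) ∞ M] [CompactSpace M]
      [SimplyConnectedSpace M]
      (g : PseudoRiemannianMetric (𝓡 4) ∞ (EuclideanSpace ℝ (Fin 4)) (TangentSpace (𝓡 4) : M → Type _))
      [g.HasLeviCivita], g.IsRiemannian →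
      ∃ χ : ℕ, 2 ≤ χ ∧
        8 * Real.pi ^ 2 * χ = 1 / 4 * g.weylEnergy.toReal + g.sigma2WeylSchoutenIntegral)
    (hAubin : ∀ (M : Type) [TopologicalSpace M] [T2Space M] [SecondCountableTopology M]
      [ChartedSpace (EuclideanSpace ℝ (Fin 4)) M] [IsManifold (𝓡 4) ∞ M] [CompactSpace M]
      [ConnectedSpace M] [MeasurableSpace M] [BorelSpace M]
      (g : PseudoRiemannianMetric (𝓡 4) ∞ (EuclideanSpace ℝ (Fin 4)) (TangentSpace (𝓡 4) : M → Type _))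
      [g.HasLeviCivita] (hg : g.IsRiemannian),
      yamabeConstant (g.toContMDiffRiemannianMetric hg) < 8 * Real.sqrt 6 * Real.pi →
      ∃ (ψ : M → ℝ)
        (g' : PseudoRiemannianMetric (𝓡 4) ∞ (EuclideanSpace ℝ (Fin 4)) (TangentSpace (𝓡 4) : M → Type _))
        (_ : g'.HasLeviCivita) (hg' : g'.IsRiemannian),
        ContMDiff (𝓡 4) 𝓘(ℝ) ∞ ψ ∧ (∀ x, 0 < ψ x) ∧
        (∀ (x : M) (v w : TangentSpace (𝓡 4) x), g'.val x v w = ψ x ^ 2 * g.val x v w) ∧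
        (∃ R₀ : ℝ, ∀ x, g'.scalarCurvature x = R₀) ∧
        ∫ x, g'.scalarCurvature x ∂(riemannianMeasure (g'.toContMDiffRiemannianMetric hg')) =
          yamabeConstant (g.toContMDiffRiemannianMetric hg) *
            Real.sqrt (riemannianMeasure (g'.toContMDiffRiemannianMetric hg') Set.univ).toReal) :
    changGurskyYang_sphere_four :=
  changGurskyYang_sphere_four_of_pic_of_chenZhu_of_chernGaussBonnet_of_aubin_of_weylConformal hPIC
    hCZ hCGB hAubin fun M _ _ _ _ _ _ g g' _ _ hg ψ hψ hpos hconf ↦ by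
      letI : MeasurableSpace M := borel M
      haveI : BorelSpace M := ⟨rfl⟩
      exact weylEnergy_conformal_sq_four g g' hg hψ hpos hconf

end Reduction

end Literature.Geometry.Riemannian

end
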